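import Summits.MatrixMultiplication.MatrixMultiplication.Theorems.SoloInformedExceptionCalculus

/-!
# The translate world: shift rules, the two-value lemma and the injectivity ending

This work, §8.8 (T13) (gen 107). Setting of `SoloInformedTransfer` (CohnUmans2013, arXiv:1207.6528, Def. 12;
coprime case, one involutory multiplier; every chart). In the TRANSLATE WORLD a doubly-rich base slice `j₀`
locks every column: `a(i,j) ∼ f i ± t j`, `b(j,k) ∼ l k ± t j` (`f = a(·,j₀)`, `l = b(j₀,·)`). The tools of
Theorem 8.21 (spread translate world ⟹ rank ≥ n³/3):

* `adm_shift_same`, `adm_shift_opp` — the SHIFT RULES: `Adm f l w` and `Adm (f+t) (l+t) w` force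
  `w ∼ f - l` unless `f + l + t = 0` or `t = 0`; `Adm f l w` and `Adm (f+t) (l-t) w` force `w ∼ f + l` unless
  `f - l + t = 0` or `t = 0` (so the sign pattern of the base slice is rank one off coincidence cells).
* `signEq_or_of_translate` — with exact translates `a ∼ f + g`, `b ∼ l - g`: `c ∼ f + l` or `c ∼ f - l + 2g`;
  `eq_or_add_eq_zero_of_signEq_two`, `Data.c_signEq_of_three` — the TWO-VALUE LEMMA: if `c(k,i) ≁ f i + l k` then
  `g` takes at most two values; three distinct values of `g` make `c` an exact translate too.
* `card_le_two_mul_card_of_signEq` — a class map `κ : G → R` (`κ x = κ y → x ∼ y`) has `|G| ≤ 2|R|`.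
* `Data.cube_le_card_mul_card_of_translate` — the INJECTIVITY ENDING: exact translate data
  `a ∼ f i + g j`, `b ∼ l k - g j`, `c ∼ f i + l k` with full separation give `n³ ≤ |S⁰| · |S¹|`
  (`τ ↦ (F τ, f i + g j + l k)` is injective), hence `n³ ≤ 2 · r · |S⁰|` (`Data.cube_le_two_mul_of_translate`);
  `Data.cube_le_two_mul_of_locked_three` combines it with the two-value lemma, and
  `Data.sq_mul_card_le_of_level` is the complementary laziness bound on a level set of `g`.
References: this work §8.4c (R1)–(R3), §8.8 (T3), (T4), (T13); CohnUmans2013 Def. 12.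
-/

namespace Summit.MatrixMultiplication.MatrixMultiplication.Theorems.TwistedTPP

namespace FibreLines

variable {ι G : Type*} [AddCommGroup G]

/-! ### Shift rules -/

/-- `x + x = 0` forces `x = 0` when there is no 2-torsion. -/
theorem eq_zero_of_add_self_eq_zero (hG : ∀ x : G, x = -x → x = 0) {x : G} (h : x + x = 0) : x = 0 :=
  hG x (eq_neg_of_add_eq_zero_left h)

/-- **Shift rule, equal signs.** `Adm f l w` and `Adm (f + t) (l + t) w` give `w ∼ f - l`, or the coincidence
`f + l + t = 0`, or `t = 0`. [this work, §8.8 (T13)] -/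
theorem adm_shift_same (hG : ∀ x : G, x = -x → x = 0) {f l w t : G} (h0 : Adm f l w)
    (h1 : Adm (f + t) (l + t) w) : SignEq w (f - l) ∨ f + l + t = 0 ∨ t = 0 := by
  have e1 : f + t - (l + t) = f - l := by abel
  have e2 : f + t + (l + t) = f + l + (t + t) := by abel
  rcases h1.signEq_add_or_sub with h1 | h1
  · rcases h0.signEq_add_or_sub with h0 | h0
    · rw [e2] at h1
      rcases h0.symm.trans h1 with h | h
      · right; right
        have ht : t + t = 0 := by
          have e : t + t = f + l + (t + t) - (f + l) := by abel
          rw [e, ← h, sub_self]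
        exact eq_zero_of_add_self_eq_zero hG ht
      · right; left
        have h2 : (f + l + t) + (f + l + t) = 0 := by
          have e : (f + l + t) + (f + l + t) = (f + l) + (f + l + (t + t)) := by abel
          rw [e]; exact add_eq_zero_iff_eq_neg.mpr h
        exact eq_zero_of_add_self_eq_zero hG h2
    · exact Or.inl h0
  · rw [e1] at h1
    exact Or.inl h1

/-- **Shift rule, opposite signs.** `Adm f l w` and `Adm (f + t) (l - t) w` give `w ∼ f + l`, or the coincidence
`f - l + t = 0`, or `t = 0`. [this work, §8.8 (T13)] -/
theorem adm_shift_opp (hG : ∀ x : G, x = -x → x = 0) {f l w t : G} (h0 : Adm f l w)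
    (h1 : Adm (f + t) (l - t) w) : SignEq w (f + l) ∨ f - l + t = 0 ∨ t = 0 := by
  have e1 : f + t + (l - t) = f + l := by abel
  have e2 : f + t - (l - t) = f - l + (t + t) := by abel
  rcases h1.signEq_add_or_sub with h1 | h1
  · rw [e1] at h1
    exact Or.inl h1
  · rcases h0.signEq_add_or_sub with h0 | h0
    · exact Or.inl h0
    · rw [e2] at h1
      rcases h0.symm.trans h1 with h | h
      · right; right
        have ht : t + t = 0 := by
          have e : t + t = f - l + (t + t) - (f - l) := by abel
          rw [e, ← h, sub_self]
        exact eq_zero_of_add_self_eq_zero hG ht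
      · right; left
        have h2 : (f - l + t) + (f - l + t) = 0 := by
          have e : (f - l + t) + (f - l + t) = (f - l) + (f - l + (t + t)) := by abel
          rw [e]; exact add_eq_zero_iff_eq_neg.mpr h
        exact eq_zero_of_add_self_eq_zero hG h2

/-! ### Exact translates and the two-value lemma -/

/-- With exact translates `a ∼ f + g`, `b ∼ l - g`, the triangle equation puts `c` in the class of `f + l` or
of `f - l + 2g`. [this work, §8.8 (T13)] -/
theorem signEq_or_of_translate {a b c f g l : G} (h : Adm a b c) (ha : SignEq a (f + g))
    (hb : SignEq b (l - g)) : SignEq c (f + l) ∨ SignEq c (f - l + g + g) := by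
  have h' : Adm (f + g) (l - g) c := (h.of_signEq_left ha).of_signEq_mid hb
  have e1 : f + g + (l - g) = f + l := by abel
  have e2 : f + g - (l - g) = f - l + g + g := by abel
  rcases h'.signEq_add_or_sub with h' | h'
  · rw [e1] at h'; exact Or.inl h'
  · rw [e2] at h'; exact Or.inr h'

/-- **Two-value lemma (pair form).** `c ∼ d + 2g` and `c ∼ d + 2g'` force `g = g'` or `d + g + g' = 0`. -/
theorem eq_or_add_eq_zero_of_signEq_two (hG : ∀ x : G, x = -x → x = 0) {c d g g' : G}
    (h : SignEq c (d + g + g)) (h' : SignEq c (d + g' + g')) : g = g' ∨ d + g + g' = 0 := by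
  rcases h.symm.trans h' with e | e
  · left
    have h2 : (g - g') + (g - g') = 0 := by
      have e' : (g - g') + (g - g') = (d + g + g) - (d + g' + g') := by abel
      rw [e', e, sub_self]
    exact sub_eq_zero.mp (eq_zero_of_add_self_eq_zero hG h2)
  · right
    have h2 : (d + g + g') + (d + g + g') = 0 := by
      have e' : (d + g + g') + (d + g + g') = (d + g + g) + (d + g' + g') := by abel
      rw [e']; exact add_eq_zero_iff_eq_neg.mpr e
    exact eq_zero_of_add_self_eq_zero hG h2

/-- **Two-value lemma (triple form).** `c` cannot lie in the classes of `d + 2g₁`, `d + 2g₂`, `d + 2g₃` for three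
pairwise distinct `gᵢ`. [this work, §8.8 (T13)] -/
theorem not_signEq_three (hG : ∀ x : G, x = -x → x = 0) {c d g₁ g₂ g₃ : G}
    (h₁ : SignEq c (d + g₁ + g₁)) (h₂ : SignEq c (d + g₂ + g₂)) (h₃ : SignEq c (d + g₃ + g₃))
    (h12 : g₁ ≠ g₂) (h13 : g₁ ≠ g₃) (h23 : g₂ ≠ g₃) : False := by
  rcases eq_or_add_eq_zero_of_signEq_two hG h₁ h₂ with e | e
  · exact h12 e
  rcases eq_or_add_eq_zero_of_signEq_two hG h₁ h₃ with e' | e'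
  · exact h13 e'
  apply h23
  have : d + g₁ + g₂ = d + g₁ + g₃ := by rw [e, e']
  exact add_left_cancel this

/-- **Three values of `g` make `c` exact.** If `a ∼ f i + g j` and `b ∼ l k - g j` for all cells and `g` takes
three distinct values, then `c(k,i) ∼ f i + l k` for every cell. [this work, §8.8 (T13)] -/
theorem Data.c_signEq_of_three (hG : ∀ x : G, x = -x → x = 0) (D : Data ι G) (f g l : ι → G)
    (ha : ∀ i j, SignEq (D.a i j) (f i + g j)) (hb : ∀ j k, SignEq (D.b j k) (l k - g j))
    {j₁ j₂ j₃ : ι} (h12 : g j₁ ≠ g j₂) (h13 : g j₁ ≠ g j₃) (h23 : g j₂ ≠ g j₃) (k i : ι) :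
    SignEq (D.c k i) (f i + l k) := by
  by_contra hc
  have h := fun j => (signEq_or_of_translate (D.adm_eqn i j k) (ha i j) (hb j k)).resolve_left hc
  exact not_signEq_three hG (h j₁) (h j₂) (h j₃) h12 h13 h23

/-! ### The injectivity ending -/

/-- A class map has fibres of size ≤ 2: `|G| ≤ 2 · |R|`. -/
theorem card_le_two_mul_card_of_signEq {R : Type*} [Fintype G] [DecidableEq G] [Fintype R] [DecidableEq R]
    (κ : G → R) (hκ : ∀ x y, κ x = κ y → SignEq x y) :
    Fintype.card G ≤ 2 * Fintype.card R := by
  classical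
  have hfib : ∀ r ∈ (Finset.univ : Finset G).image κ,
      ((Finset.univ : Finset G).filter fun x => κ x = r).card ≤ 2 := by
    intro r hr
    obtain ⟨x, -, rfl⟩ := Finset.mem_image.mp hr
    have hsub : ((Finset.univ : Finset G).filter fun y => κ y = κ x) ⊆ {x, -x} := by
      intro y hy
      simp only [Finset.mem_filter, Finset.mem_univ, true_and] at hy
      rcases hκ y x hy with h | h
      · simp [h]
      · simp [h]
    exact (Finset.card_le_card hsub).trans (Finset.card_le_two)
  have h1 := Finset.card_le_mul_card_image (Finset.univ : Finset G) 2 hfib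
  have h2 : ((Finset.univ : Finset G).image κ).card ≤ Fintype.card R := Finset.card_le_univ _
  calc Fintype.card G = (Finset.univ : Finset G).card := Finset.card_univ.symm
    _ ≤ 2 * ((Finset.univ : Finset G).image κ).card := h1
    _ ≤ 2 * Fintype.card R := Nat.mul_le_mul_left 2 h2

variable {G₀ : Type*} [AddCommGroup G₀]

/-- **Injectivity ending.** Exact translate data `a ∼ f i + g j`, `b ∼ l k - g j`, `c ∼ f i + l k` with full
separation: `τ ↦ (F τ, f i + g j + l k)` is injective, so `n³ ≤ |S⁰| · |S¹|`. [this work, §8.8 (T3)(ii), (T13)] -/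
theorem Data.cube_le_card_mul_card_of_translate [Fintype ι] [DecidableEq ι] [Fintype G₀] [DecidableEq G₀]
    [Fintype G] [DecidableEq G] (D : Data ι G) (Φ : Chart ι G₀) (hsep : D.SepAll Φ) (f g l : ι → G)
    (ha : ∀ i j, SignEq (D.a i j) (f i + g j)) (hb : ∀ j k, SignEq (D.b j k) (l k - g j))
    (hc : ∀ k i, SignEq (D.c k i) (f i + l k)) :
    Fintype.card ι ^ 3 ≤ Fintype.card G₀ * Fintype.card G := by
  classical
  let Ψ : ι × ι × ι → G₀ × G := fun τ => (Φ.F τ.1 τ.2.1 τ.2.2, f τ.1 + g τ.2.1 + l τ.2.2)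
  have hinj : Function.Injective Ψ := by
    rintro ⟨i, j, k⟩ ⟨i', j', k'⟩ hΨ
    simp only [Ψ, Prod.mk.injEq] at hΨ
    obtain ⟨hF, hG'⟩ := hΨ
    by_contra hne
    have hs := hsep i j k i' j' k' hF hne
    rw [D.sep_iff_not_adm] at hs
    apply hs
    have hadm : Adm (f i + g j) (l k - g j') (f i' + l k') := by
      right; left
      have e : f i + g j + (l k - g j') - (f i' + l k') = (f i + g j + l k) - (f i' + g j' + l k') := by abel
      rw [e, hG', sub_self]
    exact hadm.of_signEq₃ (ha i j) (hb j' k) (hc k' i')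
  have h := Fintype.card_le_of_injective Ψ hinj
  simpa [Fintype.card_prod, pow_succ, pow_zero, one_mul, mul_assoc] using h

/-- **Injectivity ending, rank form: `n³ ≤ 2 · r · |S⁰|`.** [this work, §8.8 (T13)] -/
theorem Data.cube_le_two_mul_of_translate [Fintype ι] [DecidableEq ι] [Fintype G₀] [DecidableEq G₀]
    [Fintype G] [DecidableEq G] {R : Type*} [Fintype R] [DecidableEq R] (D : Data ι G) (Φ : Chart ι G₀)
    (κ : G → R) (hκ : ∀ x y, κ x = κ y → SignEq x y) (hsep : D.SepAll Φ) (f g l : ι → G)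
    (ha : ∀ i j, SignEq (D.a i j) (f i + g j)) (hb : ∀ j k, SignEq (D.b j k) (l k - g j))
    (hc : ∀ k i, SignEq (D.c k i) (f i + l k)) :
    Fintype.card ι ^ 3 ≤ 2 * (Fintype.card R * Fintype.card G₀) := by
  have h1 := D.cube_le_card_mul_card_of_translate Φ hsep f g l ha hb hc
  have h2 := card_le_two_mul_card_of_signEq κ hκ
  calc Fintype.card ι ^ 3 ≤ Fintype.card G₀ * Fintype.card G := h1
    _ ≤ Fintype.card G₀ * (2 * Fintype.card R) := Nat.mul_le_mul_left _ h2
    _ = 2 * (Fintype.card R * Fintype.card G₀) := by ring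

/-- **Locked translates with three values of `g` ⟹ `n³ ≤ 2 · r · |S⁰|`.** [this work, §8.8 (T13), Thm 8.21] -/
theorem Data.cube_le_two_mul_of_locked_three [Fintype ι] [DecidableEq ι] [Fintype G₀] [DecidableEq G₀]
    [Fintype G] [DecidableEq G] {R : Type*} [Fintype R] [DecidableEq R] (hG : ∀ x : G, x = -x → x = 0)
    (D : Data ι G) (Φ : Chart ι G₀) (κ : G → R) (hκ : ∀ x y, κ x = κ y → SignEq x y) (hsep : D.SepAll Φ)
    (f g l : ι → G) (ha : ∀ i j, SignEq (D.a i j) (f i + g j)) (hb : ∀ j k, SignEq (D.b j k) (l k - g j))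
    {j₁ j₂ j₃ : ι} (h12 : g j₁ ≠ g j₂) (h13 : g j₁ ≠ g j₃) (h23 : g j₂ ≠ g j₃) :
    Fintype.card ι ^ 3 ≤ 2 * (Fintype.card R * Fintype.card G₀) :=
  D.cube_le_two_mul_of_translate Φ κ hκ hsep f g l ha hb (D.c_signEq_of_three hG f g l ha hb h12 h13 h23)

/-- **The complementary laziness bound.** With `b ∼ l k - g j` exact, the rows of `b` in a level set `J₀` of `g`
agree in class, so `n² · |J₀| ≤ r · |S⁰|` (lazy-row bound of `SoloInformedTransfer`). [this work, §8.8 (T13)] -/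
theorem Data.sq_mul_card_le_of_level [Fintype ι] [DecidableEq ι] [Fintype G₀] [DecidableEq G₀]
    {R : Type*} [Fintype R] [DecidableEq R] (D : Data ι G) (Φ : Chart ι G₀) (κ : G → R)
    (hκ : ∀ x y, κ x = κ y → SignEq x y) (hsep : D.SepAll Φ) (g l : ι → G)
    (hb : ∀ j k, SignEq (D.b j k) (l k - g j)) (J₀ : Finset ι) (hJ : ∀ j ∈ J₀, ∀ j' ∈ J₀, g j = g j') :
    Fintype.card ι ^ 2 * J₀.card ≤ Fintype.card R * Fintype.card G₀ := by
  refine D.sq_mul_card_le_of_b_rowsOn Φ κ hκ hsep J₀ ?_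
  intro j hj j' hj' k
  have e : l k - g j' = l k - g j := by rw [hJ j hj j' hj']
  exact (hb j' k).trans (e ▸ (hb j k).symm)

end FibreLines

end Summit.MatrixMultiplication.MatrixMultiplication.Theorems.TwistedTPP
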